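import Literature.NumberTheory.Transcendental.AnalytificationUnique
import Literature.NumberTheory.Transcendental.AbelianVarietyAnalyticLieGroup
import Literature.Geometry.Hyperkaehler.AutomorphismsTrivialOnH2LocalSystem
import Literature.AlgebraicGeometry.Hyperkaehler.OGradySixType
import Literature.AlgebraicGeometry.Hyperkaehler.GeneralizedKummerTypeTranslationGroup
import HarnessLib

/-!
# GAGA for automorphism groups: `Aut X ≃ Aut(X^an)`, carrying `Aut₀(X)` onto `Aut°(X^an)` (PROVED)

Layer `Literature/AlgebraicGeometry/Hyperkaehler`.  The scheme↔analytic END of every fixed-locus or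
local-system transport argument for hyperkähler-type varieties (cell `hodge-kum4`, rung H3 of ladder
HodgeAV; memo HOME/p2/A4-CONSUMER.md; the lit-family tranche's announced follow-up
«GAGA-for-automorphisms check», 2026-08-26): for a smooth projective `ℂ`-variety `X` with an
analytification `φ : M → X(ℂ)` (`IsAnalytification E X n φ`, holomorphic atlas on `M`),

* `analyticAut hφ : Aut X →* (M ≃ₜ M)`, `δ ↦ φ⁻¹ ∘ δ(ℂ) ∘ φ` — the self-homeomorphism of `X^an`
  underlying an automorphism of the `ℂ`-scheme `X` (defined for any analytification);
* `analyticAut_mem_holAutGroup`: it is BIHOLOMORPHIC (Serre, GAGA §2: algebraic morphisms are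
  holomorphic — the tree's PROVED `IsAnalytification.mdifferentiable_comp_map_holds`, plus Osgood,
  `contMDiff_omega_of_mdifferentiable`);
* `analyticAut_injective` (complex points separate morphisms of varieties,
  `hom_ext_of_isAnalytification`) and `exists_analyticAut_eq` (every biholomorphic self-map of `X^an` is
  algebraic — Chow/GAGA, the tree's PROVED `arapura2012_cor_15_4_6_holds` through
  `exists_iso_of_isAnalytification_of_biholomorphic`), whence `range_analyticAut = holAutGroup` and the
  group isomorphism `autEquivHolAutGroup : Aut X ≃* holAutGroup E M`;
* `singularCohomology_map_analyticAut_eq_id_iff`: `(analyticAut δ)^* = 1` on `Hᵏ(M; ℂ)` iff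
  `δ^* = 1` on `Hᵏ(X(ℂ); ℂ)` (`complexBetti`), so `δ ∈ autZero X ↔ analyticAut δ ∈ holAutZero E M`
  (Mongardi–Wandel's / Hassett–Tschinkel's `Aut₀ = Aut°`, scheme side `AlgebraicGeometry.Hyperkaehler.autZero`
  versus analytic side `Geometry.Hyperkaehler.holAutZero`) and
  `δ ∈ autFixingH2H3 X ↔ analyticAut δ ∈ holAutZero E M ∧ (analyticAut δ)^* = 1 on H³(M; ℂ)`
  (the `Kumⁿ` literature's `Γ`).

Everything is PROVED from the tree; no named fact, no instance, no notation.  Sources of the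
statements: J.-P. Serre, *Géométrie algébrique et géométrie analytique*, Ann. Inst. Fourier 6 (1956)
§2 (fonctorialité, Prop. 2) and §3 n°19–20 (Chow, morphisms); D. Mumford, *Algebraic Geometry I*,
(4.14)–(4.15); B. Hassett, Yu. Tschinkel, Mosc. Math. J. 13 (2013) §2 («`Aut(X)` the group of
holomorphic automorphisms», for `X` projective the same as the algebraic ones).
-/

noncomputable section

open scoped Manifold ContDiff Topology
open CategoryTheory Function Set
open Literature.AlgebraicGeometry.Motives (SchemeOver ComplexPoints IsSmoothProjective AlgPoints)
open Literature.NumberTheory.Transcendental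
open Literature.AlgebraicTopology.SingularHomology
open Literature.Geometry.Hyperkaehler (holAutGroup holAutZero mem_holAutGroup_iff mem_holAutZero_iff)

namespace Literature.AlgebraicGeometry.Hyperkaehler

variable {n : ℕ} {X : SchemeOver ℂ}
  {E : Type} [NormedAddCommGroup E] [NormedSpace ℂ E] [FiniteDimensional ℂ E]
  {M : Type} [TopologicalSpace M] [ChartedSpace E M] {φ : M → ComplexPoints X}

/-! ### The self-homeomorphism of `X(ℂ)` underlying an automorphism of `X` -/

/-- The self-homeomorphism `δ(ℂ)` of `X(ℂ)` (analytic topology) induced by an automorphism `δ` of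
the `ℂ`-scheme `X`, with inverse `δ⁻¹(ℂ)`. [cite: SerreGAGA1956, §2 Prop. 2] -/
def complexPointsHomeomorph (δ : Aut X) : ComplexPoints X ≃ₜ ComplexPoints X where
  toFun := AlgPoints.map δ.hom
  invFun := AlgPoints.map δ.inv
  left_inv P := by
    change AlgPoints.map δ.inv (AlgPoints.map δ.hom P) = P
    rw [← AlgPoints.map_comp_apply, δ.hom_inv_id, AlgPoints.map_id_apply]
  right_inv P := by
    change AlgPoints.map δ.hom (AlgPoints.map δ.inv P) = P
    rw [← AlgPoints.map_comp_apply, δ.inv_hom_id, AlgPoints.map_id_apply]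
  continuous_toFun := AlgPoints.continuous_map δ.hom
  continuous_invFun := AlgPoints.continuous_map δ.inv

/-- `complexPointsHomeomorph δ` is `δ(ℂ)` as a function. [cite: SerreGAGA1956, §2 Prop. 2] -/
@[simp]
theorem complexPointsHomeomorph_apply (δ : Aut X) (P : ComplexPoints X) :
    complexPointsHomeomorph δ P = AlgPoints.map δ.hom P :=
  rfl

/-! ### `analyticAut`: `Aut X → Aut(X^an)` -/

/-- **The self-map of the analytification underlying an automorphism of `X`**: for an
analytification `φ : M → X(ℂ)` and `δ ∈ Aut X`, the homeomorphism `φ⁻¹ ∘ δ(ℂ) ∘ φ` of `M`, as a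
group homomorphism `Aut X →* (M ≃ₜ M)` (both groups composing as functions: `(f * g) x = f (g x)`).
[cite: SerreGAGA1956, §2 Prop. 2] -/
def analyticAut (hφ : IsAnalytification E X n φ) : Aut X →* (M ≃ₜ M) where
  toFun δ := hφ.homeomorph.trans ((complexPointsHomeomorph δ).trans hφ.homeomorph.symm)
  map_one' := by
    ext x
    change hφ.homeomorph.symm (AlgPoints.map (𝟙 X) (φ x)) = x
    rw [AlgPoints.map_id_apply]
    exact hφ.homeomorph.symm_apply_apply x
  map_mul' δ₁ δ₂ := by
    ext x
    change hφ.homeomorph.symm (AlgPoints.map (δ₂.hom ≫ δ₁.hom) (φ x)) =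
      hφ.homeomorph.symm (AlgPoints.map δ₁.hom (φ (hφ.homeomorph.symm (AlgPoints.map δ₂.hom (φ x)))))
    rw [AlgPoints.map_comp_apply]
    congr 2
    exact (hφ.homeomorph.apply_symm_apply _).symm

/-- Defining identity: `φ (analyticAut δ x) = δ(ℂ) (φ x)`. [cite: SerreGAGA1956, §2 Prop. 2] -/
theorem apply_analyticAut (hφ : IsAnalytification E X n φ) (δ : Aut X) (x : M) :
    φ (analyticAut hφ δ x) = AlgPoints.map δ.hom (φ x) := by
  change φ (hφ.homeomorph.symm (AlgPoints.map δ.hom (φ x))) = _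
  exact hφ.homeomorph.apply_symm_apply _

/-- `analyticAut δ` is the map `x ↦ φ⁻¹ (δ(ℂ) (φ x))`. [cite: SerreGAGA1956, §2 Prop. 2] -/
theorem analyticAut_apply (hφ : IsAnalytification E X n φ) (δ : Aut X) (x : M) :
    analyticAut hφ δ x = hφ.homeomorph.symm (AlgPoints.map δ.hom (φ x)) :=
  rfl

/-- As a continuous map, `analyticAut δ = φ⁻¹ ∘ δ(ℂ) ∘ φ`. [cite: SerreGAGA1956, §2 Prop. 2] -/
theorem toContinuousMap_analyticAut (hφ : IsAnalytification E X n φ) (δ : Aut X) :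
    ((analyticAut hφ δ : M ≃ₜ M) : C(M, M)) =
      (hφ.homeomorph.symm : C(ComplexPoints X, M)).comp
        ((AlgPoints.mapContinuous δ.hom).comp (hφ.homeomorph : C(M, ComplexPoints X))) :=
  rfl

/-- **Complex points separate automorphisms**: `analyticAut` is injective for `X` smooth
projective (`hom_ext_of_isAnalytification`). [cite: Mumford1981, §4B (4.15)] -/
theorem analyticAut_injective (hX : IsSmoothProjective n X) (hφ : IsAnalytification E X n φ) :
    Injective (analyticAut hφ) := by
  intro δ₁ δ₂ h
  have hhom : δ₁.hom = δ₂.hom :=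
    hom_ext_of_isAnalytification hX hX hφ fun x => by
      rw [← apply_analyticAut hφ δ₁ x, ← apply_analyticAut hφ δ₂ x, h]
  exact Aut.ext hhom

section Holomorphic

variable [IsManifold 𝓘(ℂ, E) ω M]

/-- `analyticAut δ` is holomorphic (GAGA: algebraic morphisms are holomorphic on analytifications,
`IsAnalytification.mdifferentiable_comp_map_holds`). [cite: SerreGAGA1956, §2 Prop. 2] -/
theorem mdifferentiable_analyticAut (hX : IsSmoothProjective n X) (hφ : IsAnalytification E X n φ)
    (δ : Aut X) : MDifferentiable 𝓘(ℂ, E) 𝓘(ℂ, E) (analyticAut hφ δ) := by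
  haveI : AlgebraicGeometry.SmoothOfRelativeDimension n X.hom := hX.smoothOfRelativeDimension
  haveI : AlgebraicGeometry.Smooth X.hom := AlgebraicGeometry.SmoothOfRelativeDimension.smooth n X.hom
  haveI : AlgebraicGeometry.LocallyOfFiniteType X.hom := inferInstance
  exact IsAnalytification.mdifferentiable_comp_map_holds hφ hφ δ.hom (analyticAut hφ δ)
    (funext (apply_analyticAut hφ δ))

/-- `analyticAut δ` is `C^ω` (holomorphic maps between complex manifolds are analytic — Osgood,
`contMDiff_omega_of_mdifferentiable`). [cite: SerreGAGA1956, §2 Prop. 2] -/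
theorem contMDiff_analyticAut (hX : IsSmoothProjective n X) (hφ : IsAnalytification E X n φ)
    (δ : Aut X) : ContMDiff 𝓘(ℂ, E) 𝓘(ℂ, E) ω (analyticAut hφ δ) := by
  haveI : CompleteSpace E := FiniteDimensional.complete ℂ E
  exact contMDiff_omega_of_mdifferentiable (mdifferentiable_analyticAut hX hφ δ)

/-- **`analyticAut δ` is a biholomorphic self-map of `X^an`** (it and its inverse
`analyticAut δ⁻¹` are holomorphic). [cite: SerreGAGA1956, §2 Prop. 2] -/
theorem analyticAut_mem_holAutGroup (hX : IsSmoothProjective n X) (hφ : IsAnalytification E X n φ)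
    (δ : Aut X) : analyticAut hφ δ ∈ holAutGroup E M := by
  refine (mem_holAutGroup_iff _).2 ⟨contMDiff_analyticAut hX hφ δ, ?_⟩
  have h : ((analyticAut hφ δ).symm : M → M) = analyticAut hφ δ⁻¹ := by
    rw [map_inv]; rfl
  rw [h]
  exact contMDiff_analyticAut hX hφ δ⁻¹

/-- **Every biholomorphic self-map of `X^an` is algebraic** (Chow + GAGA: the tree's PROVED
`arapura2012_cor_15_4_6_holds`, in the biholomorphic form `exists_iso_of_isAnalytification_of_biholomorphic`).
[cite: Mumford1981, §4B (4.14)–(4.15)] [cite: Arapura2012, §15.4 Cor. 15.4.6] -/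
theorem exists_analyticAut_eq (hX : IsSmoothProjective n X) (hφ : IsAnalytification E X n φ)
    {h : M ≃ₜ M} (hh : h ∈ holAutGroup E M) : ∃ δ : Aut X, analyticAut hφ δ = h := by
  obtain ⟨h₁, h₂⟩ := (mem_holAutGroup_iff h).1 hh
  obtain ⟨e, he, -⟩ := exists_iso_of_isAnalytification_of_biholomorphic hX hX hφ hφ
    (h := (h : M → M)) (h' := (h.symm : M → M)) (h₁.mdifferentiable (by simp))
    (h₂.mdifferentiable (by simp)) h.symm_apply_apply h.apply_symm_apply
  refine ⟨e, ?_⟩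
  ext x
  rw [analyticAut_apply, ← he x]
  exact hφ.homeomorph.symm_apply_apply (h x)

/-- The range of `analyticAut` is exactly the group of biholomorphic self-maps of `X^an`.
[cite: SerreGAGA1956, §2 Prop. 2] [cite: Mumford1981, §4B (4.15)] -/
theorem range_analyticAut (hX : IsSmoothProjective n X) (hφ : IsAnalytification E X n φ) :
    (analyticAut hφ).range = holAutGroup E M := by
  ext h
  constructor
  · rintro ⟨δ, rfl⟩
    exact analyticAut_mem_holAutGroup hX hφ δ
  · intro hh
    obtain ⟨δ, hδ⟩ := exists_analyticAut_eq hX hφ hh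
    exact ⟨δ, hδ⟩

/-- **GAGA for automorphism groups**: `Aut X ≃* Aut(X^an)` — the automorphism group of the smooth
projective `ℂ`-scheme `X` is the group of biholomorphic self-maps of its analytification, via
`δ ↦ φ⁻¹ ∘ δ(ℂ) ∘ φ`. [cite: SerreGAGA1956, §2 Prop. 2 and §3 n°20] [cite: Mumford1981, §4B (4.15)] -/
def autEquivHolAutGroup (hX : IsSmoothProjective n X) (hφ : IsAnalytification E X n φ) :
    Aut X ≃* holAutGroup E M :=
  (MonoidHom.ofInjective (analyticAut_injective hX hφ)).trans
    (MulEquiv.subgroupCongr (range_analyticAut hX hφ))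

/-- `autEquivHolAutGroup δ` is `analyticAut δ`. [cite: SerreGAGA1956, §2 Prop. 2] -/
@[simp]
theorem coe_autEquivHolAutGroup (hX : IsSmoothProjective n X) (hφ : IsAnalytification E X n φ)
    (δ : Aut X) : (autEquivHolAutGroup hX hφ δ : M ≃ₜ M) = analyticAut hφ δ :=
  rfl

end Holomorphic

/-! ### Action on cohomology: `Aut₀(X) ↔ Aut°(X^an)`, `Γ(X) ↔` trivial on `H² ⊕ H³` -/

/-- Pull-back by the homeomorphism `φ : M ≃ X(ℂ)` on `Hᵏ(·; ℂ)` followed by pull-back by `φ⁻¹` is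
the identity. [cite: Hatcher2002, §3.1] -/
theorem singularCohomology_map_homeomorph_comp_symm (hφ : IsAnalytification E X n φ) (k : ℕ) :
    singularCohomology.map ℂ ℂ (hφ.homeomorph : C(M, ComplexPoints X)) k ≫
        singularCohomology.map ℂ ℂ (hφ.homeomorph.symm : C(ComplexPoints X, M)) k = 𝟙 _ := by
  rw [← singularCohomology.map_comp]
  have h : (hφ.homeomorph : C(M, ComplexPoints X)).comp
      (hφ.homeomorph.symm : C(ComplexPoints X, M)) = ContinuousMap.id _ :=
    ContinuousMap.ext fun P => hφ.homeomorph.apply_symm_apply P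
  rw [h, singularCohomology.map_id]

/-- Pull-back by `φ⁻¹` followed by pull-back by `φ` is the identity on `Hᵏ(M; ℂ)`.
[cite: Hatcher2002, §3.1] -/
theorem singularCohomology_map_symm_comp_homeomorph (hφ : IsAnalytification E X n φ) (k : ℕ) :
    singularCohomology.map ℂ ℂ (hφ.homeomorph.symm : C(ComplexPoints X, M)) k ≫
        singularCohomology.map ℂ ℂ (hφ.homeomorph : C(M, ComplexPoints X)) k = 𝟙 _ := by
  rw [← singularCohomology.map_comp]
  have h : (hφ.homeomorph.symm : C(ComplexPoints X, M)).comp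
      (hφ.homeomorph : C(M, ComplexPoints X)) = ContinuousMap.id _ :=
    ContinuousMap.ext fun x => hφ.homeomorph.symm_apply_apply x
  rw [h, singularCohomology.map_id]

/-- `(analyticAut δ)^* = (φ⁻¹)^* ∘ δ^* ∘ φ^*` on `Hᵏ(M; ℂ)`, with `δ^* = complexBetti.map δ.hom k`
on `Hᵏ(X(ℂ); ℂ)` (written in diagrammatic order). [cite: Hatcher2002, §3.1] -/
theorem singularCohomology_map_analyticAut (hφ : IsAnalytification E X n φ) (δ : Aut X) (k : ℕ) :
    singularCohomology.map ℂ ℂ ((analyticAut hφ δ : M ≃ₜ M) : C(M, M)) k =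
      singularCohomology.map ℂ ℂ (hφ.homeomorph.symm : C(ComplexPoints X, M)) k ≫
        HodgeTheory.complexBetti.map δ.hom k ≫
          singularCohomology.map ℂ ℂ (hφ.homeomorph : C(M, ComplexPoints X)) k := by
  rw [toContinuousMap_analyticAut, singularCohomology.map_comp, singularCohomology.map_comp]

/-- **`(analyticAut δ)^* = 1` on `Hᵏ(X^an; ℂ)` iff `δ^* = 1` on `Hᵏ(X(ℂ); ℂ)`.**
[cite: Hatcher2002, §3.1] [cite: HassettTschinkel2013, §2 (p. 3)] -/
theorem singularCohomology_map_analyticAut_eq_id_iff (hφ : IsAnalytification E X n φ) (δ : Aut X)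
    (k : ℕ) :
    singularCohomology.map ℂ ℂ ((analyticAut hφ δ : M ≃ₜ M) : C(M, M)) k = 𝟙 _ ↔
      HodgeTheory.complexBetti.map δ.hom k = 𝟙 _ := by
  have A := singularCohomology_map_homeomorph_comp_symm hφ k
  have B := singularCohomology_map_symm_comp_homeomorph hφ k
  rw [singularCohomology_map_analyticAut]
  constructor
  · intro h
    have h' := congrArg (fun f => singularCohomology.map ℂ ℂ
        (hφ.homeomorph : C(M, ComplexPoints X)) k ≫ f ≫
          singularCohomology.map ℂ ℂ (hφ.homeomorph.symm : C(ComplexPoints X, M)) k) h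
    simp only [Category.assoc, Category.id_comp] at h'
    rw [reassoc_of% A, A, Category.comp_id] at h'
    exact h'
  · intro h
    rw [h, Category.id_comp, B]

/-- **`Aut₀(X) = Aut°(X^an)`**: `δ` acts trivially on `H²(X(ℂ); ℂ)` iff the biholomorphic map
`analyticAut δ` acts trivially on `H²(X^an; ℂ)` — the scheme-side `autZero` versus the analytic
`holAutZero` of Hassett–Tschinkel. [cite: HassettTschinkel2013, §2 (p. 3)] [cite: MongardiWandel2017, Thm. 4.2] -/
theorem mem_autZero_iff_analyticAut_mem_holAutZero [IsManifold 𝓘(ℂ, E) ω M]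
    (hX : IsSmoothProjective n X) (hφ : IsAnalytification E X n φ) (δ : Aut X) :
    δ ∈ autZero X ↔ analyticAut hφ δ ∈ holAutZero E M := by
  rw [mem_autZero_iff, mem_holAutZero_iff, singularCohomology_map_analyticAut_eq_id_iff]
  exact ⟨fun h => ⟨analyticAut_mem_holAutGroup hX hφ δ, h⟩, fun h => h.2⟩

/-- `autEquivHolAutGroup` maps `Aut₀(X)` onto `Aut°(X^an)`. [cite: HassettTschinkel2013, §2 (p. 3)] -/
theorem map_autZero_autEquivHolAutGroup [IsManifold 𝓘(ℂ, E) ω M] (hX : IsSmoothProjective n X)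
    (hφ : IsAnalytification E X n φ) :
    (autZero X).map (autEquivHolAutGroup hX hφ).toMonoidHom =
      (holAutZero E M).subgroupOf (holAutGroup E M) := by
  ext ⟨h, hh⟩
  simp only [Subgroup.mem_map, Subgroup.mem_subgroupOf, MulEquiv.coe_toMonoidHom]
  constructor
  · rintro ⟨δ, hδ, hδh⟩
    have : (analyticAut hφ δ : M ≃ₜ M) = h := by
      rw [← coe_autEquivHolAutGroup hX hφ δ, hδh]
    rw [← this]
    exact (mem_autZero_iff_analyticAut_mem_holAutZero hX hφ δ).1 hδ
  · intro hh0
    obtain ⟨δ, hδ⟩ := exists_analyticAut_eq hX hφ hh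
    refine ⟨δ, (mem_autZero_iff_analyticAut_mem_holAutZero hX hφ δ).2 (hδ ▸ hh0), ?_⟩
    exact Subtype.ext (by rw [coe_autEquivHolAutGroup, hδ])

/-- **`Γ(X)` read on `X^an`**: `δ ∈ autFixingH2H3 X` (trivial on `H²` and `H³` of `X(ℂ)`) iff
`analyticAut δ ∈ Aut°(X^an)` and `(analyticAut δ)^* = 1` on `H³(X^an; ℂ)`.
[cite: Floccari2023, §2.5] [cite: HassettTschinkel2013, §2 (p. 3)] -/
theorem mem_autFixingH2H3_iff_analyticAut [IsManifold 𝓘(ℂ, E) ω M] (hX : IsSmoothProjective n X)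
    (hφ : IsAnalytification E X n φ) (δ : Aut X) :
    δ ∈ autFixingH2H3 X ↔ analyticAut hφ δ ∈ holAutZero E M ∧
      singularCohomology.map ℂ ℂ ((analyticAut hφ δ : M ≃ₜ M) : C(M, M)) 3 = 𝟙 _ := by
  rw [mem_autFixingH2H3_iff, ← mem_autZero_iff, mem_autZero_iff_analyticAut_mem_holAutZero hX hφ,
    singularCohomology_map_analyticAut_eq_id_iff]

/-- Fixed points correspond: `x` is fixed by `analyticAut δ` iff `φ x` is fixed by `δ(ℂ)`.
[cite: SerreGAGA1956, §2 Prop. 2] -/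
theorem analyticAut_apply_eq_self_iff (hφ : IsAnalytification E X n φ) (δ : Aut X) (x : M) :
    analyticAut hφ δ x = x ↔ AlgPoints.map δ.hom (φ x) = φ x := by
  rw [analyticAut_apply, Homeomorph.symm_apply_eq, IsAnalytification.coe_homeomorph, eq_comm]

/-- The fixed-point set of `analyticAut δ` is the `φ`-preimage of the fixed-point set of `δ(ℂ)`;
as `φ` is a bijection the two fixed-point sets are in bijection. [cite: SerreGAGA1956, §2 Prop. 2] -/
theorem fixedPoints_analyticAut (hφ : IsAnalytification E X n φ) (δ : Aut X) :
    {x : M | analyticAut hφ δ x = x} = φ ⁻¹' {P | AlgPoints.map δ.hom P = P} := by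
  ext x
  exact analyticAut_apply_eq_self_iff hφ δ x

/-- `φ` restricts to a bijection between the fixed points of `analyticAut δ` on `X^an` and the fixed
points of `δ(ℂ)` on `X(ℂ)`; in particular the two fixed-point sets have the same cardinality
(`Set.ncard`, `0` for infinite sets). [cite: SerreGAGA1956, §2 Prop. 2] -/
theorem ncard_fixedPoints_analyticAut (hφ : IsAnalytification E X n φ) (δ : Aut X) :
    {x : M | analyticAut hφ δ x = x}.ncard = {P : ComplexPoints X | AlgPoints.map δ.hom P = P}.ncard := by
  rw [fixedPoints_analyticAut]
  exact Set.ncard_preimage_of_injective_subset_range hφ.isHomeomorph.injective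
    (by rw [hφ.isHomeomorph.surjective.range_eq]; exact Set.subset_univ _)

/-- The fixed-point set of `analyticAut δ` is finite iff that of `δ(ℂ)` is.
[cite: SerreGAGA1956, §2 Prop. 2] -/
theorem finite_fixedPoints_analyticAut_iff (hφ : IsAnalytification E X n φ) (δ : Aut X) :
    {x : M | analyticAut hφ δ x = x}.Finite ↔ {P : ComplexPoints X | AlgPoints.map δ.hom P = P}.Finite := by
  rw [fixedPoints_analyticAut]
  refine ⟨fun h => ?_, fun h => h.preimage hφ.isHomeomorph.injective.injOn⟩
  have := h.image φ
  rwa [Set.image_preimage_eq _ hφ.isHomeomorph.surjective] at this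

end Literature.AlgebraicGeometry.Hyperkaehler

end
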